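import Summits.AtomisticToContinuum.HydrodynamicLimit.Theorems.ImplosionDichotomyPolynomialCompressionLocalTheory
import Literature.MathematicalPhysics.KineticTheory.HardSphereEulerContinuationHolds

/-!
# Stub 3 of the line `log-lipschitz-budget`, unconditionally: conditional existence from a-priori bounds

File for the crux `ImplosionDichotomy.PolynomialCompression` (stmt-AtomisticToContinuum-12587), registered skeleton
`Lines/log-lipschitz-budget.lean`, stub `stub_conditionalExistence`: a classical hard-sphere Euler solution with smooth
positive small-packing data exists on `[0, T')` as soon as every solution on `[0, T)`, `T ≤ T'`, with these data obeys the
uniform `(M, η₁)`-bounds. This is `stub_conditionalExistence_of_localTheory` (landed, conditional on the two named facts of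
the local theory) with the named facts now PROVED in the Literature library:
`hsEuler_localExistence_holds` and `hsEuler_continuation_holds` (Dafermos, symmetric-hyperbolic local theory).
-/

noncomputable section

namespace Summit.AtomisticToContinuum.HydrodynamicLimit.Theorems

open Set
open Literature.MathematicalPhysics.KineticTheory Literature.Analysis.FunctionSpaces

/-- **Stub 3, `stub_conditionalExistence`** (registered skeleton of the line `log-lipschitz-budget`), unconditional:
conditional existence on `[0, T')` from uniform a-priori `(M, η₁)`-bounds of all solutions on `[0, T)`, `T ≤ T'`, for
smooth positive data of packing `≤ η₁` — `stub_conditionalExistence_of_localTheory` applied to the proved local theory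
`hsEuler_localExistence_holds`, `hsEuler_continuation_holds`. [folklore] -/
theorem stub_conditionalExistence :
    ∀ η₀ : ℝ, 0 < η₀ → ∀ F : ℝ → ℝ, AnalyticOnNhd ℝ F (Ioo (-η₀) η₀) →
      EqOn hsExcessFreeEnergy F (Ico 0 η₀) → F 0 = 0 → deriv F 0 = 2 * Real.pi / 3 →
      ∃ η₁ : ℝ, 0 < η₁ ∧ ∀ σ : ℝ, 0 < σ →
        ∀ (ρ₀ θ₀ : T3 → ℝ) (u₀ : T3 → V3), Torus.IsSmooth ρ₀ → Torus.IsSmooth θ₀ →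
          Torus.IsSmooth u₀ → (∀ x, 0 < ρ₀ x) → (∀ x, 0 < θ₀ x) → (∀ x, ρ₀ x * σ ^ 3 ≤ η₁) →
          ∀ T' M : ℝ, 0 < T' → 0 < M →
            (∀ T : ℝ, T ≤ T' → ∀ (ρ θ : ℝ → T3 → ℝ) (u : ℝ → T3 → V3),
                IsHardSphereEulerSolution σ T ρ u θ → ρ 0 = ρ₀ → u 0 = u₀ → θ 0 = θ₀ →
                ∀ t ∈ Ico 0 T, ∀ x,
                  M⁻¹ ≤ ρ t x ∧ ρ t x ≤ M ∧ M⁻¹ ≤ θ t x ∧ θ t x ≤ M ∧ ‖u t x‖ ≤ M ∧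
                  ρ t x * σ ^ 3 ≤ η₁ ∧
                  ∀ i : Fin 3, ‖Torus.partialDeriv i (u t) x‖ ≤ M ∧
                    |Torus.partialDeriv i (ρ t) x| ≤ M ∧ |Torus.partialDeriv i (θ t) x| ≤ M) →
            ∃ (ρ θ : ℝ → T3 → ℝ) (u : ℝ → T3 → V3),
              IsHardSphereEulerSolution σ T' ρ u θ ∧ ρ 0 = ρ₀ ∧ u 0 = u₀ ∧ θ 0 = θ₀ :=
  stub_conditionalExistence_of_localTheory hsEuler_localExistence_holds hsEuler_continuation_holds

end Summit.AtomisticToContinuum.HydrodynamicLimit.Theorems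

end
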